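import Literature.MathematicalPhysics.QuantumFieldTheory.Balaban1983to89.B6GluedDistWindowL0
import HarnessLib
import Literature.MathematicalPhysics.QuantumFieldTheory.Balaban1983to89.B6Geom246MultiLevelBoxL0
import Literature.MathematicalPhysics.QuantumFieldTheory.Balaban1983to89.B6GlobalChartV1L0
import Literature.MathematicalPhysics.QuantumFieldTheory.Balaban1983to89.B6MultiLevelTorusOperatorL0
import Literature.MathematicalPhysics.QuantumFieldTheory.Balaban1983to89.B6ScalarAgreeV1ChartL0
import Literature.MathematicalPhysics.QuantumFieldTheory.Balaban1983to89.B6ScalarFactorsChartV1L0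
import Literature.MathematicalPhysics.QuantumFieldTheory.Balaban1983to89.B8Ineq192MultiLevelTorusL0
import Literature.MathematicalPhysics.QuantumFieldTheory.Balaban1983to89.B6GluedLegsWindow

/-!
# `Balaban1983to89.B6GluedLegsWindowL0` — LEVEL-0 TWIN (programme G-F3′-L0, director-ym LINE №27 / UV3-NODE §24.5; plan `lit-balaban-r03/G-F3L0-PLAN.md`) of `B6GluedLegsWindow`:
the same declarations, SAME NAMES AND STATEMENTS, for nested families WITH print's region `Λ₀ = T ∖ Ω₁` ADMITTED (structures
`B6MultiLevelBoxOperatorL0.Domains` / `B6MultiLevelTorusOperatorL0.TDomains`: levels `0, …, k`, the level-`0` block a single site, `Q′₀ = id`,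
finite weight `a₀` — print p.225 (2.14) «Σ_{j=0}^k … (Q′₀λ)(x) = λ(x), x ∈ Λ₀», p.229 «taking a sequence (2.1) … smallest possible domains B^j(Λ_j),
and considering the operator Δ_a defined by (2.19), (2.20) for this sequence»).  Every `D`-free object is the lineage's, consumed BY NAME; no existing
module is touched; no fact is minted.  Unit `lit-balaban-p21` (packet S-B owner, S-C tail; p21 gen 27; port tooling by r03 gen 36 / p33 gen 88); B6 fold owner r03; referee ref-4.  THE TWIN'S DOCUMENTATION FOLLOWS
VERBATIM (its «levels 1 … k» / «Ω₁ = X» sentences describe the twin; here `j` runs from `0` and `Ω₁` may be a proper subset).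

# [B6] Prop. 2.6, line 3 of (2.92): the CUT LEGS `ζ∂·G̃′_□` and `G̃′_□·∂*h` of the transplanted member through the window, and their
(2.67)₂,₃-shape majorants on the glued geometry — the member-side inputs `mEGw′`, `mGwE′` (and `mGw`, `mSw`) of p38's
`B6DomainChangeP2134Sizes.line3P_hasMajorant_cut`

statement-level skeleton of published theorems with citation tags; proofs where landed; nothing here is a claim about the Yang–Mills mass gap

[tag: formalized_from_source] (construction ours; (2.67) *"|(G′λ)(x)|, |(∇G′λ)(x)|, |(G′∇*λ)(x)|, … ≦ O(1)[(L^jη)², L^jη, L^jη, …]·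
e^{−½δ₀d(y,y′)}|λ|"* is [cite: Balaban1984PropagatorsII, (2.67) p.234] (its two leg entries are used, with the constants renamed `C₁`, `δ`);
the member torus and its operators are p.238–239.)

## What

For the member `T_□` (p21 torus family `D₁` over the member's V1 torus, r03's bijective site/bond window charts `cS`, `cB` of corner `x₀`)
and a member operator `T′` on site functions (`G′_□ = GpV hN₁ D₁ c`):

* §1 the global `∂` of an extended member function IS the member's `∂` on the bonds of margin `1` (`dE_extendOp_apply`), and the window
  restriction of the global `∂*` of a bond function supported on bonds of margin `1` IS the member's `∂*` of the restricted bond function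
  (`restrictOp_dsE_eq`) — the stencils of `∂`, `∂*` do not see the periodic identification away from the faces;
* §2 the restriction of a block-supported test function is block-supported on `T_□` (sites and bonds), or vanishes if the block misses the window;
* §3 **`mEGw′`**: `HasMajorantHom (blkS) (blkV1) ((mulOp ζ ∘ₗ ∂) ∘ₗ εT′ρ) (φ(j)e^{−δd′})` from the member's `HasMajorantHom (∂ ∘ₗ T′) (φ(j)e^{−δd_{T_□}})`
  for bond cut-offs `ζ` (`|ζ| ≤ 1`) supported on bonds of margin `1`; **`mGwE′`**: `HasMajorantHom (blkV1) (blkS) (εT′ρ ∘ₗ (∂* ∘ₗ mulOp h)) (…)`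
  from the member's `HasMajorantHom (T′ ∘ₗ ∂*) (…)`, `h` likewise;
* §4 the four member-side inputs of the line-3 size theorem in print's (2.67)/(2.87) shapes (`len`-form), from `B6ScalarFactorsChartV1L0.factors_V1_TB`
  applied to the member: `mGw`, `mEGw′`, `mGwE′`, `mSw` on `geomW` (`member_line3_inputs`).

Hypotheses: `hlevW`, `hal` of `B6ScalarAgreeV1Chart` (levels agree through the chart; `L^{k₁} ∣ x₀`).  No measure, no Yang–Mills claim.
-/

open scoped BigOperators
open Finset

namespace Literature.MathematicalPhysics.QuantumFieldTheory.Balaban1983to89.B6GluedLegsWindowL0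

open B4Reflection242 (boxDom)
open B6MultiLevelBoxOperator (N0)
open B6MultiLevelTorusOperatorL0 (TDomains)
open B6Geom246MultiLevelBoxL0 (bset blkOf)
open B8Ineq192MultiLevelTorusL0 (geomTB geomTB_len)
open B6RandomWalk (HasMajorant BlockSupp)
open B6RandomWalkHom (HasMajorantHom)
open B6Ineq2133TwoScaleV1 (onFun onFun_apply)
open B6SectAOperatorsV1 (dE dsE dE_apply dsE_apply)
open B6Prop26Gluing (mulOp mulOp_apply)
open B6Prop26ReachTransplant (restrictOp extendOp transplant restrictOp_apply_of_injOn restrictOp_apply_of_not_mem extendOp_apply transplant_apply)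
open B6GlobalChartV1 (PV toBox)
open B6GlobalChartV1L0 (blkV1)
open B6ScalarFactorsChartV1L0 (blkS blkV1_eq_blkS GpV SV factors_V1_TB)
open B6Prop25TwoScaleCensus (TSIdx)
open B6AgreeLapV1Chart (WChart eS eB DeepS DeepB deepS_mono eS_surj eS_shift eS_shift_eq_iff' cS cB mem_cS_W mem_cB_W cS_e cB_e
  shift_mem_deepS unshift_mem_deepS)
open B6ScalarAgreeV1Chart (exists_window_preimage)
open B6ScalarAgreeV1ChartL0 (blkOf_eS_eq_iff)
open B6GluedDistWindowL0 (geomW geomW_dist geomW_len ψblk ψblk_blkOf distW_ψ_le hasMajorant_member_W)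
open Literature.MathematicalPhysics.QuantumFieldTheory.Balaban1983to89.B6GluedLegsWindow (dE_extendOp_apply restrictB_unshift_apply restrictOp_dsE_eq)

variable {d ℓ : ℕ} {m K : ℕ} {hd : 1 ≤ d + 1} {hL : Odd (ℓ + 1) ∧ 1 < ℓ + 1} {Mh k R : ℕ} {P' : Fin (d + 1) → ℕ}
variable (hN : ∀ μ, N0 ℓ Mh k P' μ = (PV d ℓ m K hd hL).sitesPerDir 0) (D : TDomains d ℓ Mh k P' R)
variable {a₀ a₁ : ℝ} {t : TSIdx d (ℓ + 1) hd hL a₀ a₁} {x₀ : Fin (d + 1) → ℤ}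
variable (hx₀ : ∀ μ, 0 ≤ x₀ μ) (hfit : ∀ μ, x₀ μ + (t.P.sitesPerDir 0 : ℕ) ≤ ((PV d ℓ m K hd hL).sitesPerDir 0 : ℕ))
variable {Mh₁ k₁ R₁ : ℕ} {P₁ : Fin (d + 1) → ℕ}
variable (hN₁ : ∀ μ, N0 ℓ Mh₁ k₁ P₁ μ = (PV d ℓ t.m t.K hd hL).sitesPerDir 0) (D₁ : TDomains d ℓ Mh₁ k₁ P₁ R₁)

/-! ## §1  The stencils `∂`, `∂*` through the window away from the faces -/

section Stencils

end Stencils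

/-! ## §2  Restrictions of block-supported test functions -/

section TestFunctions

/-- **a site test function supported on the global block of a window site restricts to one supported on the corresponding member block**
(same bound). [cite: Balaban1984PropagatorsII, (2.51) p.232 («supp λ ⊂ B^{j′}(y′)»), p.238–239; derivation ours] -/
theorem blockSupp_restrictS (hlevW : ∀ x ∈ DeepS t x₀ 0, D₁.lev (toBox hN₁ (eS t x₀ x) : Fin (d + 1) → ℤ) = D.lev (toBox hN x))
    (hal : ∀ μ, (((ℓ + 1) ^ k₁ : ℕ) : ℤ) ∣ x₀ μ) {μ : Site (PV d ℓ m K hd hL) 0 → ℝ} {y' : ↥(B6Geom246MultiLevelBoxL0.bset D.toDomains)} {B : ℝ}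
    (hμ : BlockSupp (g := geomW hN D hx₀ hfit hN₁ D₁) (blkS hN D) μ y' B) {xs : Site (PV d ℓ m K hd hL) 0} (hxs : xs ∈ DeepS t x₀ 0)
    (hys : blkS hN D xs = y') :
    BlockSupp (g := geomTB D₁) (blkS hN₁ D₁) (restrictOp (cS t x₀ hx₀ hfit).W (eS t x₀) μ) (blkS hN₁ D₁ (eS t x₀ xs)) B := by
  have hinjS := (cS t x₀ hx₀ hfit).inj
  simp only [cS_e] at hinjS
  refine ⟨hμ.nonneg, fun x₁ _ => ?_, fun x₁ hx₁ => ?_⟩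
  · obtain ⟨x, hx, rfl⟩ := (cS t x₀ hx₀ hfit).surj x₁
    rw [cS_e, restrictOp_apply_of_injOn hinjS _ hx]
    by_cases hb : blkS hN D x = y'
    · exact hμ.bound x hb
    · rw [hμ.off x hb, abs_zero]; exact hμ.nonneg
  · obtain ⟨x, hx, rfl⟩ := (cS t x₀ hx₀ hfit).surj x₁
    rw [cS_e, restrictOp_apply_of_injOn hinjS _ hx]
    refine hμ.off x fun hb => hx₁ ?_
    rw [cS_e]
    exact (blkOf_eS_eq_iff hN D hN₁ D₁ hlevW hal (mem_cS_W.1 hx) hxs).2 (hb.trans hys.symm)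

omit hN₁ D₁ in
/-- a site test function supported on a block missing the window restricts to `0`. [cite: Balaban1984PropagatorsII, (2.51) p.232, dictionary] -/
theorem restrictS_eq_zero {μ : Site (PV d ℓ m K hd hL) 0 → ℝ} {y' : ↥(B6Geom246MultiLevelBoxL0.bset D.toDomains)} (hμ : ∀ x, blkS hN D x ≠ y' → μ x = 0)
    (hy : ¬ ∃ xs ∈ (cS t x₀ hx₀ hfit).W, blkS hN D xs = y') :
    restrictOp (cS t x₀ hx₀ hfit).W (eS t x₀) μ = 0 := by
  have hinjS := (cS t x₀ hx₀ hfit).inj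
  simp only [cS_e] at hinjS
  funext x₁
  obtain ⟨x, hx, rfl⟩ := (cS t x₀ hx₀ hfit).surj x₁
  rw [cS_e, restrictOp_apply_of_injOn hinjS _ hx, Pi.zero_apply]
  exact hμ x fun hb => hy ⟨x, hx, hb⟩

/-- **a bond test function supported on the global block (of initial points) restricts to one supported on the corresponding member block.**
[cite: Balaban1984PropagatorsII, (2.51) p.232, p.224 («Ω also the set of bonds»), p.238–239; derivation ours] -/
theorem blockSupp_restrictB (hlevW : ∀ x ∈ DeepS t x₀ 0, D₁.lev (toBox hN₁ (eS t x₀ x) : Fin (d + 1) → ℤ) = D.lev (toBox hN x))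
    (hal : ∀ μ, (((ℓ + 1) ^ k₁ : ℕ) : ℤ) ∣ x₀ μ) {A : PBond (PV d ℓ m K hd hL) 0 → ℝ} {y' : ↥(B6Geom246MultiLevelBoxL0.bset D.toDomains)} {B : ℝ}
    (hA : BlockSupp (g := geomW hN D hx₀ hfit hN₁ D₁) (blkV1 hN D) A y' B) {xs : Site (PV d ℓ m K hd hL) 0} (hxs : xs ∈ DeepS t x₀ 0)
    (hys : blkS hN D xs = y') :
    BlockSupp (g := geomTB D₁) (blkV1 hN₁ D₁) (restrictOp (cB t x₀ hx₀ hfit).W (eB t x₀) A) (blkS hN₁ D₁ (eS t x₀ xs)) B := by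
  have hinjB := (cB t x₀ hx₀ hfit).inj
  simp only [cB_e] at hinjB
  refine ⟨hA.nonneg, fun b₁ _ => ?_, fun b₁ hb₁ => ?_⟩
  · obtain ⟨b, hb, rfl⟩ := (cB t x₀ hx₀ hfit).surj b₁
    rw [cB_e, restrictOp_apply_of_injOn hinjB _ hb]
    by_cases hbb : blkV1 hN D b = y'
    · exact hA.bound b hbb
    · rw [hA.off b hbb, abs_zero]; exact hA.nonneg
  · obtain ⟨b, hb, rfl⟩ := (cB t x₀ hx₀ hfit).surj b₁
    rw [cB_e, restrictOp_apply_of_injOn hinjB _ hb]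
    refine hA.off b fun hbb => hb₁ ?_
    rw [cB_e, blkV1_eq_blkS]
    show blkS hN₁ D₁ (eS t x₀ b.src) = blkS hN₁ D₁ (eS t x₀ xs)
    rw [blkV1_eq_blkS] at hbb
    exact (blkOf_eS_eq_iff hN D hN₁ D₁ hlevW hal (mem_cB_W.1 hb) hxs).2 (hbb.trans hys.symm)

omit hN₁ D₁ in
/-- a bond test function supported on a block missing the window restricts to `0`. [cite: Balaban1984PropagatorsII, (2.51) p.232, dictionary] -/
theorem restrictB_eq_zero {A : PBond (PV d ℓ m K hd hL) 0 → ℝ} {y' : ↥(B6Geom246MultiLevelBoxL0.bset D.toDomains)}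
    (hA : ∀ b, blkV1 hN D b ≠ y' → A b = 0) (hy : ¬ ∃ xs ∈ (cS t x₀ hx₀ hfit).W, blkS hN D xs = y') :
    restrictOp (cB t x₀ hx₀ hfit).W (eB t x₀) A = 0 := by
  have hinjB := (cB t x₀ hx₀ hfit).inj
  simp only [cB_e] at hinjB
  funext b₁
  obtain ⟨b, hb, rfl⟩ := (cB t x₀ hx₀ hfit).surj b₁
  rw [cB_e, restrictOp_apply_of_injOn hinjB _ hb, Pi.zero_apply]
  exact hA b fun hbb => hy ⟨b.src, mem_cS_W.2 (mem_cB_W.1 hb), by rw [blkV1_eq_blkS] at hbb; exact hbb⟩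

end TestFunctions

/-! ## §3  The cut legs of the transplanted member and their majorants on the glued geometry -/

section Legs

/-- kernel comparison through `ψ`: levels agree and `d′ ≤ d_{T_□}` on window blocks. [cite: Balaban1984PropagatorsII, (2.46) p.231, p.238–239; derivation ours] -/
theorem kernel_compare (hlevW : ∀ x ∈ DeepS t x₀ 0, D₁.lev (toBox hN₁ (eS t x₀ x) : Fin (d + 1) → ℤ) = D.lev (toBox hN x))
    (hal : ∀ μ, (((ℓ + 1) ^ k₁ : ℕ) : ℤ) ∣ x₀ μ) (hMh₁ : 1 ≤ Mh₁) (hP₁ : ∀ μ, 1 ≤ P₁ μ) {φ : ℕ → ℝ} (hφ : ∀ j, 0 ≤ φ j) {δ : ℝ}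
    (hδ : 0 ≤ δ) {x xs : Site (PV d ℓ m K hd hL) 0} (hx : x ∈ DeepS t x₀ 0) (hxs : xs ∈ DeepS t x₀ 0) :
    φ (B6ScalarFactorsChartV1L0.blkS hN₁ D₁ (eS t x₀ x)).1.1 * Real.exp (-(δ * (geomTB D₁).dist (blkS hN₁ D₁ (eS t x₀ x)) (blkS hN₁ D₁ (eS t x₀ xs)))) ≤
      φ (blkS hN D x).1.1 * Real.exp (-(δ * (geomW hN D hx₀ hfit hN₁ D₁).dist (blkS hN D x) (blkS hN D xs))) := by
  have hl : (blkS hN₁ D₁ (eS t x₀ x)).1.1 = (blkS hN D x).1.1 := by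
    show D₁.toDomains.lev _ = D.toDomains.lev _
    simp only [B6MultiLevelTorusOperatorL0.TDomains.toDomains_lev]
    exact hlevW x hx
  have hd : (geomW hN D hx₀ hfit hN₁ D₁).dist (blkS hN D x) (blkS hN D xs) ≤
      (geomTB D₁).dist (blkS hN₁ D₁ (eS t x₀ x)) (blkS hN₁ D₁ (eS t x₀ xs)) := by
    have := distW_ψ_le hN D hx₀ hfit hN₁ D₁ hlevW hal hMh₁ hP₁ (blkS hN₁ D₁ (eS t x₀ x)) (blkS hN₁ D₁ (eS t x₀ xs))
    rwa [show ψblk hN D hx₀ hfit hN₁ D₁ (blkS hN₁ D₁ (eS t x₀ x)) = blkS hN D x from ψblk_blkOf hN D hx₀ hfit hN₁ D₁ hlevW hal hx,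
      show ψblk hN D hx₀ hfit hN₁ D₁ (blkS hN₁ D₁ (eS t x₀ xs)) = blkS hN D xs from ψblk_blkOf hN D hx₀ hfit hN₁ D₁ hlevW hal hxs] at this
  rw [hl]
  exact mul_le_mul_of_nonneg_left (Real.exp_le_exp.2 (by nlinarith)) (hφ _)

/-- **`mEGw′` — THE CUT LEFT LEG OF THE TRANSPLANTED MEMBER**: if `∂∘T′` has the member majorant `φ(j)e^{−δd_{T_□}}` (sites → bonds of `T_□`), then for a
bond cut-off `ζ` (`|ζ| ≤ 1`) supported on bonds of margin `1`, `(ζ∂)∘(εT′ρ)` has the majorant `φ(j)e^{−δd′}` on `T_η` (sites → bonds), all pairs.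
[cite: Balaban1984PropagatorsII, (2.67) p.234 («|(∇G′λ)(x)|»), (2.92) p.239 line 3, p.238–239 (T_□); derivation ours] -/
theorem hasMajorantHom_cutLeft_W
    (hlevW : ∀ x ∈ DeepS t x₀ 0, TDomains.lev D₁ (toBox hN₁ (eS t x₀ x) : Fin (d + 1) → ℤ) = D.lev (toBox hN x))
    (hal : ∀ μ, (((ℓ + 1) ^ k₁ : ℕ) : ℤ) ∣ x₀ μ) (hMh₁ : 1 ≤ Mh₁) (hP₁ : ∀ μ, 1 ≤ P₁ μ) {T' : Module.End ℝ (Site t.P 0 → ℝ)} {c : ℝ}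
    {φ : ℕ → ℝ} (hφ : ∀ j, 0 ≤ φ j) {δ : ℝ} (hδ : 0 ≤ δ)
    (hT' : HasMajorantHom (g := geomTB D₁) (blkS hN₁ D₁) (blkV1 hN₁ D₁) (onFun (dE (P := t.P) c) ∘ₗ T')
      (fun y y' => φ y.1.1 * Real.exp (-(δ * (geomTB D₁).dist y y'))))
    (ζ : PBond (PV d ℓ m K hd hL) 0 → ℝ) (hζ1 : ∀ b, |ζ b| ≤ 1) (hζ : ∀ b, ζ b ≠ 0 → b.src ∈ DeepS t x₀ 1) :
    HasMajorantHom (g := geomW hN D hx₀ hfit hN₁ D₁) (blkS hN D) (blkV1 hN D)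
      ((mulOp ζ ∘ₗ onFun (dE (P := PV d ℓ m K hd hL) c)) ∘ₗ transplant (cS t x₀ hx₀ hfit).W (eS t x₀) T')
      (fun y y' => φ y.1.1 * Real.exp (-(δ * (geomW hN D hx₀ hfit hN₁ D₁).dist y y'))) := by
  classical
  intro y' μ B hμ b
  have hB : 0 ≤ B := hμ.nonneg
  have hK : 0 ≤ φ (blkV1 hN D b).1.1 * Real.exp (-(δ * (geomW hN D hx₀ hfit hN₁ D₁).dist (blkV1 hN D b) y')) * B :=
    mul_nonneg (mul_nonneg (hφ _) (Real.exp_pos _).le) hB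
  rw [LinearMap.comp_apply, LinearMap.comp_apply, mulOp_apply]
  by_cases hzb : ζ b = 0
  · rw [hzb, zero_mul, abs_zero]; exact hK
  have hb : b.src ∈ DeepS t x₀ 1 := hζ b hzb
  -- the global `∂` of the extended member function is the member's `∂`
  have hval : onFun (dE (P := PV d ℓ m K hd hL) c) (transplant (cS t x₀ hx₀ hfit).W (eS t x₀) T' μ) b =
      (onFun (dE (P := t.P) c) ∘ₗ T') (restrictOp (cS t x₀ hx₀ hfit).W (eS t x₀) μ) (eB t x₀ b) := by
    rw [LinearMap.comp_apply, ← dE_extendOp_apply hx₀ hfit c _ hb]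
    rfl
  rw [hval, abs_mul]
  by_cases hy : ∃ xs ∈ (cS t x₀ hx₀ hfit).W, blkS hN D xs = y'
  · obtain ⟨xs, hxsW, hys⟩ := hy
    have hxs : xs ∈ DeepS t x₀ 0 := mem_cS_W.1 hxsW
    have hsupp := blockSupp_restrictS hN D hx₀ hfit hN₁ D₁ hlevW hal hμ hxs hys
    have h1 := hT' _ _ B hsupp (eB t x₀ b)
    have hcmp := kernel_compare hN D hx₀ hfit hN₁ D₁ hlevW hal hMh₁ hP₁ hφ hδ (deepS_mono (by omega) hb) hxs
    rw [hys] at hcmp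
    have hblk : blkV1 hN₁ D₁ (eB t x₀ b) = blkS hN₁ D₁ (eS t x₀ b.src) := rfl
    rw [hblk] at h1
    calc |ζ b| * |(onFun (dE (P := t.P) c) ∘ₗ T') (restrictOp (cS t x₀ hx₀ hfit).W (eS t x₀) μ) (eB t x₀ b)|
        ≤ 1 * (φ (blkS hN₁ D₁ (eS t x₀ b.src)).1.1 *
            Real.exp (-(δ * (geomTB D₁).dist (blkS hN₁ D₁ (eS t x₀ b.src)) (blkS hN₁ D₁ (eS t x₀ xs)))) * B) :=
          mul_le_mul (hζ1 b) h1 (abs_nonneg _) zero_le_one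
      _ ≤ φ (blkV1 hN D b).1.1 * Real.exp (-(δ * (geomW hN D hx₀ hfit hN₁ D₁).dist (blkV1 hN D b) y')) * B := by
          rw [one_mul]; exact mul_le_mul_of_nonneg_right hcmp hB
  · have h0 : restrictOp (cS t x₀ hx₀ hfit).W (eS t x₀) μ = 0 := restrictS_eq_zero hN D hx₀ hfit hμ.off hy
    rw [h0, map_zero, Pi.zero_apply, abs_zero, mul_zero]
    exact hK

/-- **`mGwE′` — THE CUT RIGHT LEG OF THE TRANSPLANTED MEMBER**: if `T′∘∂*` has the member majorant `φ(j)e^{−δd_{T_□}}` (bonds → sites of `T_□`), then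
for a bond cut-off `h` (`|h| ≤ 1`) supported on bonds of margin `1`, `(εT′ρ)∘(∂*∘h)` has the majorant `φ(j)e^{−δd′}` on `T_η` (bonds → sites), all pairs.
[cite: Balaban1984PropagatorsII, (2.67) p.234 («|(G′∇*λ)(x)|»), (2.92) p.239 line 3, p.238–239 (T_□); derivation ours] -/
theorem hasMajorantHom_cutRight_W
    (hlevW : ∀ x ∈ DeepS t x₀ 0, TDomains.lev D₁ (toBox hN₁ (eS t x₀ x) : Fin (d + 1) → ℤ) = D.lev (toBox hN x))
    (hal : ∀ μ, (((ℓ + 1) ^ k₁ : ℕ) : ℤ) ∣ x₀ μ) (hMh₁ : 1 ≤ Mh₁) (hP₁ : ∀ μ, 1 ≤ P₁ μ) {T' : Module.End ℝ (Site t.P 0 → ℝ)} {c : ℝ}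
    {φ : ℕ → ℝ} (hφ : ∀ j, 0 ≤ φ j) {δ : ℝ} (hδ : 0 ≤ δ)
    (hT' : HasMajorantHom (g := geomTB D₁) (blkV1 hN₁ D₁) (blkS hN₁ D₁) (T' ∘ₗ onFun (dsE (P := t.P) c))
      (fun y y' => φ y.1.1 * Real.exp (-(δ * (geomTB D₁).dist y y'))))
    (h : PBond (PV d ℓ m K hd hL) 0 → ℝ) (hh1 : ∀ b, |h b| ≤ 1) (hh : ∀ b, h b ≠ 0 → b.src ∈ DeepS t x₀ 1) :
    HasMajorantHom (g := geomW hN D hx₀ hfit hN₁ D₁) (blkV1 hN D) (blkS hN D)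
      (transplant (cS t x₀ hx₀ hfit).W (eS t x₀) T' ∘ₗ (onFun (dsE (P := PV d ℓ m K hd hL) c) ∘ₗ mulOp h))
      (fun y y' => φ y.1.1 * Real.exp (-(δ * (geomW hN D hx₀ hfit hN₁ D₁).dist y y'))) := by
  classical
  intro y' A B hA x
  have hB : 0 ≤ B := hA.nonneg
  have hK : 0 ≤ φ (blkS hN D x).1.1 * Real.exp (-(δ * (geomW hN D hx₀ hfit hN₁ D₁).dist (blkS hN D x) y')) * B :=
    mul_nonneg (mul_nonneg (hφ _) (Real.exp_pos _).le) hB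
  rw [LinearMap.comp_apply, LinearMap.comp_apply, transplant_apply]
  by_cases hxW : x ∈ (cS t x₀ hx₀ hfit).W
  swap
  · rw [if_neg hxW, abs_zero]; exact hK
  rw [if_pos hxW]
  have hx : x ∈ DeepS t x₀ 0 := mem_cS_W.1 hxW
  -- the cut test function `hA` lives on bonds of margin 1
  have hhA : ∀ b, mulOp h A b ≠ 0 → b.src ∈ DeepS t x₀ 1 := fun b hb => by
    rw [mulOp_apply] at hb
    exact hh b (left_ne_zero_of_mul hb)
  rw [restrictOp_dsE_eq hx₀ hfit c hhA, ← LinearMap.comp_apply]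
  by_cases hy : ∃ xs ∈ (cS t x₀ hx₀ hfit).W, blkS hN D xs = y'
  · obtain ⟨xs, hxsW, hys⟩ := hy
    have hxs : xs ∈ DeepS t x₀ 0 := mem_cS_W.1 hxsW
    -- `hA` is block-supported with the same bound
    have hA' : BlockSupp (g := geomW hN D hx₀ hfit hN₁ D₁) (blkV1 hN D) (mulOp h A) y' B := by
      refine ⟨hB, fun b hb => ?_, fun b hb => ?_⟩
      · rw [mulOp_apply, abs_mul]
        calc |h b| * |A b| ≤ 1 * B := mul_le_mul (hh1 b) (hA.bound b hb) (abs_nonneg _) zero_le_one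
          _ = B := one_mul B
      · rw [mulOp_apply, hA.off b hb, mul_zero]
    have hsupp := blockSupp_restrictB hN D hx₀ hfit hN₁ D₁ hlevW hal hA' hxs hys
    have h1 := hT' _ _ B hsupp (eS t x₀ x)
    have hcmp := kernel_compare hN D hx₀ hfit hN₁ D₁ hlevW hal hMh₁ hP₁ hφ hδ hx hxs
    rw [hys] at hcmp
    exact h1.trans (mul_le_mul_of_nonneg_right hcmp hB)
  · have h0 : restrictOp (cB t x₀ hx₀ hfit).W (eB t x₀) (mulOp h A) = 0 :=
      restrictB_eq_zero hN D hx₀ hfit (fun b hb => by rw [mulOp_apply, hA.off b hb, mul_zero]) hy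
    rw [h0, map_zero, Pi.zero_apply, abs_zero]
    exact hK

end Legs

/-! ## §4  The member-side inputs of the line-3 size theorem, in print's (2.67)/(2.87) shapes -/

section Inputs

/-- **THE FOUR MEMBER-SIDE INPUTS OF LINE 3 ON THE GLUED GEOMETRY** (`mGw`, `mEGw′`, `mGwE′`, `mSw` of p38's `line3P_hasMajorant_cut`): with the
constants `M₁, δ, C` of `B6ScalarFactorsChartV1L0.factors_V1_TB` (on `d, L` only), for every member torus (`P₁ ≥ 4`, `R₁ ≥ 2L`, `L·M_{h,1} ≥ M₁`)
charted into the window of a global torus with the level/alignment hypotheses, every fine factor `c ≠ 0` and bond cut-offs `ζ, h` (`|·| ≤ 1`)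
on bonds of margin `1`: `G̃′_□ = εG′_□ρ`, `ζ∂·G̃′_□`, `G̃′_□·∂*h`, `S̃_□ = εS_□ρ` have the majorants
`c⁻²C·len²·e^{−δd′}`, `|c|⁻¹C·len·e^{−δd′}`, `(d+1)|c|⁻¹C·len·e^{−δd′}`, `c⁴C·len⁻⁴·e^{−δd′}` for ALL block pairs of `T_η`.
[cite: Balaban1984PropagatorsII, (2.67) p.234, (2.87) p.238, (2.92) p.239 line 3, p.238–239 (T_□); derivation ours] -/
theorem member_line3_inputs (d ℓ : ℕ) (hd : 1 ≤ d + 1) (hL : Odd (ℓ + 1) ∧ 1 < ℓ + 1) :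
    ∃ M₁ δ C : ℝ, 0 < M₁ ∧ 0 < δ ∧ 0 < C ∧
      ∀ (m K : ℕ) {Mh k R : ℕ} {P' : Fin (d + 1) → ℕ} (hN : ∀ μ, N0 ℓ Mh k P' μ = (PV d ℓ m K hd hL).sitesPerDir 0)
        (D : B6MultiLevelTorusOperatorL0.TDomains d ℓ Mh k P' R) {a₀ a₁ : ℝ} {t : TSIdx d (ℓ + 1) hd hL a₀ a₁} {x₀ : Fin (d + 1) → ℤ}
        (hx₀ : ∀ μ, 0 ≤ x₀ μ) (hfit : ∀ μ, x₀ μ + (t.P.sitesPerDir 0 : ℕ) ≤ ((PV d ℓ m K hd hL).sitesPerDir 0 : ℕ))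
        {Mh₁ k₁ R₁ : ℕ} {P₁ : Fin (d + 1) → ℕ} (hN₁ : ∀ μ, N0 ℓ Mh₁ k₁ P₁ μ = (PV d ℓ t.m t.K hd hL).sitesPerDir 0)
        (D₁ : TDomains d ℓ Mh₁ k₁ P₁ R₁),
        (∀ x ∈ DeepS t x₀ 0, D₁.lev (toBox hN₁ (eS t x₀ x) : Fin (d + 1) → ℤ) = D.lev (toBox hN x)) →
        (∀ μ, (((ℓ + 1) ^ k₁ : ℕ) : ℤ) ∣ x₀ μ) → 1 ≤ Mh₁ → (∀ μ, 4 ≤ P₁ μ) → 2 * (ℓ + 1) ≤ R₁ → M₁ ≤ ((ℓ : ℝ) + 1) * Mh₁ →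
        ∀ {c : ℝ}, c ≠ 0 → ∀ (ζ h : PBond (PV d ℓ m K hd hL) 0 → ℝ), (∀ b, |ζ b| ≤ 1) → (∀ b, ζ b ≠ 0 → b.src ∈ DeepS t x₀ 1) →
          (∀ b, |h b| ≤ 1) → (∀ b, h b ≠ 0 → b.src ∈ DeepS t x₀ 1) →
          HasMajorant (g := geomW hN D hx₀ hfit hN₁ D₁) (blkS hN D) (transplant (cS t x₀ hx₀ hfit).W (eS t x₀) (GpV hN₁ D₁ c))
            (fun y y' => (c ^ 2)⁻¹ * C * (geomW hN D hx₀ hfit hN₁ D₁).len y ^ 2 *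
              Real.exp (-(δ * (geomW hN D hx₀ hfit hN₁ D₁).dist y y'))) ∧
          HasMajorantHom (g := geomW hN D hx₀ hfit hN₁ D₁) (blkS hN D) (blkV1 hN D)
            ((mulOp ζ ∘ₗ onFun (dE (P := PV d ℓ m K hd hL) c)) ∘ₗ transplant (cS t x₀ hx₀ hfit).W (eS t x₀) (GpV hN₁ D₁ c))
            (fun y y' => |c|⁻¹ * C * (geomW hN D hx₀ hfit hN₁ D₁).len y * Real.exp (-(δ * (geomW hN D hx₀ hfit hN₁ D₁).dist y y'))) ∧
          HasMajorantHom (g := geomW hN D hx₀ hfit hN₁ D₁) (blkV1 hN D) (blkS hN D)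
            (transplant (cS t x₀ hx₀ hfit).W (eS t x₀) (GpV hN₁ D₁ c) ∘ₗ (onFun (dsE (P := PV d ℓ m K hd hL) c) ∘ₗ mulOp h))
            (fun y y' => ((d : ℝ) + 1) * |c|⁻¹ * C * (geomW hN D hx₀ hfit hN₁ D₁).len y *
              Real.exp (-(δ * (geomW hN D hx₀ hfit hN₁ D₁).dist y y'))) ∧
          HasMajorant (g := geomW hN D hx₀ hfit hN₁ D₁) (blkS hN D) (transplant (cS t x₀ hx₀ hfit).W (eS t x₀) (SV hN₁ D₁ c))
            (fun y y' => c ^ 4 * C * ((geomW hN D hx₀ hfit hN₁ D₁).len y ^ 4)⁻¹ *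
              Real.exp (-(δ * (geomW hN D hx₀ hfit hN₁ D₁).dist y y'))) := by
  obtain ⟨M₁, δ, C, hM₁, hδ, hC, hfac⟩ := factors_V1_TB d ℓ hd hL
  refine ⟨M₁, δ, C, hM₁, hδ, hC, ?_⟩
  intro m K Mh k R P' hN D a₀ a₁ t x₀ hx₀ hfit Mh₁ k₁ R₁ P₁ hN₁ D₁ hlevW hal hMh₁ hP4 hR hM c hc ζ h hζ1 hζ hh1 hh
  have hP₁ : ∀ μ, 1 ≤ P₁ μ := fun μ => le_trans (by norm_num) (hP4 μ)
  obtain ⟨h1, h2, h3, h4⟩ := hfac t.m t.K hN₁ D₁ hP4 hR hM hc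
  have hL0 : (0 : ℝ) ≤ (ℓ : ℝ) + 1 := by positivity
  refine ⟨?_, ?_, ?_, ?_⟩
  · exact hasMajorant_member_W hN D hx₀ hfit hN₁ D₁ hlevW hal hMh₁ hP₁
      (φ := fun j => (c ^ 2)⁻¹ * C * (((ℓ : ℝ) + 1) ^ j * 1) ^ 2) (fun j => by positivity) hδ.le h1
  · exact hasMajorantHom_cutLeft_W hN D hx₀ hfit hN₁ D₁ hlevW hal hMh₁ hP₁
      (φ := fun j => |c|⁻¹ * C * (((ℓ : ℝ) + 1) ^ j * 1)) (fun j => by positivity) hδ.le h2 ζ hζ1 hζ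
  · exact hasMajorantHom_cutRight_W hN D hx₀ hfit hN₁ D₁ hlevW hal hMh₁ hP₁
      (φ := fun j => ((d : ℝ) + 1) * |c|⁻¹ * C * (((ℓ : ℝ) + 1) ^ j * 1)) (fun j => by positivity) hδ.le h3 h hh1 hh
  · exact hasMajorant_member_W hN D hx₀ hfit hN₁ D₁ hlevW hal hMh₁ hP₁
      (φ := fun j => c ^ 4 * C * ((((ℓ : ℝ) + 1) ^ j * 1) ^ 4)⁻¹) (fun j => by positivity) hδ.le h4

end Inputs

end Literature.MathematicalPhysics.QuantumFieldTheory.Balaban1983to89.B6GluedLegsWindowL0
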